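import Mathlib.AlgebraicGeometry.AlgebraicCycle.Basic
import Mathlib.AlgebraicGeometry.OrderOfVanishing
import Mathlib.AlgebraicGeometry.FunctionField
import Mathlib.AlgebraicGeometry.Morphisms.ClosedImmersion
import Mathlib.AlgebraicGeometry.Morphisms.Proper
import Mathlib.AlgebraicGeometry.Morphisms.FiniteType
import Mathlib.Topology.LocallyFinsupp
import Mathlib.GroupTheory.QuotientGroup.Defs
import Summits.Ventures.HodgeRepro2.HostAPI.Carriers.AlgebraicGeometry.Motives.Varieties
import Summits.Ventures.HodgeRepro2.HostAPI.Util.ForallBinderLint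
open HostAPI.Carriers

universe u

open CategoryTheory AlgebraicGeometry Order

namespace HostAPI.Carriers.AlgebraicGeometry.Motives

section Graded

variable (X : Scheme.{u})

def cyclesOfDim (d : ℕ) : AddSubgroup (AlgebraicCycle X ℤ) where
  carrier := {c | ∀ z, c z ≠ 0 → Order.height z = d}
  zero_mem' := fun z hz ↦ (hz rfl).elim
  add_mem' := by
    intro a b ha hb z hz
    by_cases h : a z = 0
    · refine hb z ?_
      simpa [h] using hz
    · exact ha z h
  neg_mem' := by
    intro a ha z hz
    exact ha z (by simpa using hz)

def cyclesOfCodim (p : ℕ) : AddSubgroup (AlgebraicCycle X ℤ) where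
  carrier := {c | ∀ z, c z ≠ 0 → Order.coheight z = p}
  zero_mem' := fun z hz ↦ (hz rfl).elim
  add_mem' := by
    intro a b ha hb z hz
    by_cases h : a z = 0
    · refine hb z ?_
      simpa [h] using hz
    · exact ha z h
  neg_mem' := by
    intro a ha z hz
    exact ha z (by simpa using hz)

variable {X}

lemma mem_cyclesOfDim_iff {d : ℕ} {c : AlgebraicCycle X ℤ} :
    c ∈ cyclesOfDim X d ↔ ∀ z, c z ≠ 0 → Order.height z = d := Iff.rfl

lemma mem_cyclesOfCodim_iff {p : ℕ} {c : AlgebraicCycle X ℤ} :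
    c ∈ cyclesOfCodim X p ↔ ∀ z, c z ≠ 0 → Order.coheight z = p := Iff.rfl

open scoped Classical in

noncomputable def primeCycle (z : X) : AlgebraicCycle X ℤ :=
  Function.locallyFinsuppWithin.single z 1

@[simp]
lemma primeCycle_apply_self (z : X) : primeCycle z z = 1 := by
  classical
  simp [primeCycle, Function.locallyFinsuppWithin.single_apply]

lemma primeCycle_apply_of_ne {z z' : X} (h : z' ≠ z) : primeCycle z z' = 0 := by
  classical
  simp [primeCycle, Function.locallyFinsuppWithin.single_apply, h]

lemma primeCycle_mem_cyclesOfDim {z : X} {d : ℕ} (hz : Order.height z = d) :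
    primeCycle z ∈ cyclesOfDim X d := by
  intro z' hz'
  by_cases h : z' = z
  · subst h; exact hz
  · exact (hz' (primeCycle_apply_of_ne h)).elim

lemma primeCycle_mem_cyclesOfCodim {z : X} {p : ℕ} (hz : Order.coheight z = p) :
    primeCycle z ∈ cyclesOfCodim X p := by
  intro z' hz'
  by_cases h : z' = z
  · subst h; exact hz
  · exact (hz' (primeCycle_apply_of_ne h)).elim

def IsEffectiveCycle (c : AlgebraicCycle X ℤ) : Prop := 0 ≤ c

lemma isEffectiveCycle_primeCycle (z : X) : IsEffectiveCycle (primeCycle z) := by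
  classical
  simpa [IsEffectiveCycle, primeCycle] using
    (Function.locallyFinsuppWithin.single_pos_int_one (x := z)).le

end Graded

structure ClosedSubvariety (X : Scheme.{u}) where

  carrier : Scheme.{u}

  ι : carrier ⟶ X

  [isClosedImmersion : IsClosedImmersion ι]

  [isIntegral : IsIntegral carrier]

namespace ClosedSubvariety

attribute [instance] isClosedImmersion isIntegral

variable {X : Scheme.{u}} (W : ClosedSubvariety X)

noncomputable def genericPoint : X := W.ι.base (_root_.genericPoint W.carrier)

noncomputable def dim : ℕ∞ := Order.height W.genericPoint

noncomputable def codim : ℕ∞ := Order.coheight W.genericPoint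

lemma ι_base_injective : Function.Injective W.ι.base := W.ι.isClosedEmbedding.injective

open scoped Classical in

noncomputable def divFun [IsLocallyNoetherian W.carrier] (f : W.carrier.functionField) : X → ℤ :=
  fun z ↦ if h : ∃ w, W.ι.base w = z then Scheme.ord f h.choose else 0

lemma divFun_ι_base [IsLocallyNoetherian W.carrier] (f : W.carrier.functionField)
    (w : W.carrier) : W.divFun f (W.ι.base w) = Scheme.ord f w := by
  have h : ∃ w', W.ι.base w' = W.ι.base w := ⟨w, rfl⟩
  simp only [divFun, dif_pos h]
  congr 1
  exact W.ι_base_injective h.choose_spec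

lemma divFun_of_notMem_range [IsLocallyNoetherian W.carrier] (f : W.carrier.functionField)
    {z : X} (hz : z ∉ Set.range W.ι.base) : W.divFun f z = 0 := by
  have h : ¬ ∃ w, W.ι.base w = z := hz
  simp only [divFun, dif_neg h]

@[simp]
lemma divFun_zero [IsLocallyNoetherian W.carrier] : W.divFun 0 = 0 := by
  ext z
  simp only [divFun, Scheme.ord_zero, Pi.zero_apply, dite_eq_ite, ite_self]

def locallyFiniteSupport_divFun : Prop :=
  ∀ [IsLocallyNoetherian W.carrier] (f : W.carrier.functionField),
    LocallyFiniteSupport (W.divFun f)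

noncomputable def div [IsLocallyNoetherian W.carrier] (h : W.locallyFiniteSupport_divFun)
    (f : W.carrier.functionField) : AlgebraicCycle X ℤ where
  toFun := W.divFun f
  supportWithinDomain' := Set.subset_univ _
  supportLocallyFiniteWithinDomain' z _ := h f z

@[simp]
lemma div_apply [IsLocallyNoetherian W.carrier] (h : W.locallyFiniteSupport_divFun)
    (f : W.carrier.functionField) (z : X) : W.div h f z = W.divFun f z := rfl

end ClosedSubvariety

section Rat

variable (X : Scheme.{u}) (d : ℕ)

def ratEquivGenerators : Set (AlgebraicCycle X ℤ) :=
  {c | c ∈ cyclesOfDim X d ∧ ∃ (W : ClosedSubvariety X) (_ : IsLocallyNoetherian W.carrier)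
    (f : W.carrier.functionField), f ≠ 0 ∧ W.dim = d + 1 ∧ ⇑c = W.divFun f}

def ratTrivial : AddSubgroup (AlgebraicCycle X ℤ) := AddSubgroup.closure (ratEquivGenerators X d)

lemma ratEquivGenerators_subset : ratEquivGenerators X d ⊆ cyclesOfDim X d := fun _ h ↦ h.1

lemma ratTrivial_le_cyclesOfDim : ratTrivial X d ≤ cyclesOfDim X d :=
  (AddSubgroup.closure_le _).mpr (ratEquivGenerators_subset X d)

variable {X}

def IsRationallyEquivalent (c c' : AlgebraicCycle X ℤ) (d : ℕ) : Prop := c - c' ∈ ratTrivial X d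

variable {d}

lemma IsRationallyEquivalent.refl (c : AlgebraicCycle X ℤ) : IsRationallyEquivalent c c d := by
  simp [IsRationallyEquivalent]

lemma IsRationallyEquivalent.symm {c c' : AlgebraicCycle X ℤ} (h : IsRationallyEquivalent c c' d) :
    IsRationallyEquivalent c' c d := by
  simpa [IsRationallyEquivalent] using (ratTrivial X d).neg_mem h

lemma IsRationallyEquivalent.trans {c c' c'' : AlgebraicCycle X ℤ}
    (h : IsRationallyEquivalent c c' d) (h' : IsRationallyEquivalent c' c'' d) :
    IsRationallyEquivalent c c'' d := by
  simpa [IsRationallyEquivalent] using (ratTrivial X d).add_mem h h'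

def divFun_mem_cyclesOfDim : Prop :=
  ∀ {k : Type u} [Field k] (X : SchemeOver k) [LocallyOfFiniteType X.hom] (W : ClosedSubvariety X.left)
    [IsLocallyNoetherian W.carrier] {d : ℕ} {f : W.carrier.functionField},
    W.dim = d + 1 → f ≠ 0 → ∀ c : AlgebraicCycle X.left ℤ, ⇑c = W.divFun f → c ∈ cyclesOfDim X.left d

variable (X d)

def ChowGroup : Type u := ↥(cyclesOfDim X d) ⧸ (ratTrivial X d).addSubgroupOf (cyclesOfDim X d)

namespace ChowGroup

noncomputable instance : AddCommGroup (ChowGroup X d) :=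
  inferInstanceAs (AddCommGroup (↥(cyclesOfDim X d) ⧸ (ratTrivial X d).addSubgroupOf _))

noncomputable instance : Inhabited (ChowGroup X d) := ⟨0⟩

noncomputable def mk : ↥(cyclesOfDim X d) →+ ChowGroup X d := QuotientAddGroup.mk' _

variable {X d}

noncomputable def ofPoint (z : X) (hz : Order.height z = d) : ChowGroup X d :=
  mk X d ⟨primeCycle z, primeCycle_mem_cyclesOfDim hz⟩

lemma mk_surjective : Function.Surjective (mk X d) := QuotientAddGroup.mk'_surjective _

@[elab_as_elim]
lemma induction_on {motive : ChowGroup X d → Prop} (x : ChowGroup X d)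
    (h : ∀ c : ↥(cyclesOfDim X d), motive (mk X d c)) : motive x :=
  QuotientAddGroup.induction_on x h

lemma mk_eq_mk_iff {c c' : ↥(cyclesOfDim X d)} :
    mk X d c = mk X d c' ↔ IsRationallyEquivalent (c : AlgebraicCycle X ℤ) c' d := by
  change (QuotientAddGroup.mk c :
      ↥(cyclesOfDim X d) ⧸ (ratTrivial X d).addSubgroupOf (cyclesOfDim X d)) =
    QuotientAddGroup.mk c' ↔ _
  rw [QuotientAddGroup.eq_iff_sub_mem, AddSubgroup.mem_addSubgroupOf]
  rfl

lemma mk_eq_zero_iff {c : ↥(cyclesOfDim X d)} :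
    mk X d c = 0 ↔ (c : AlgebraicCycle X ℤ) ∈ ratTrivial X d := by
  change (QuotientAddGroup.mk c :
      ↥(cyclesOfDim X d) ⧸ (ratTrivial X d).addSubgroupOf (cyclesOfDim X d)) = 0 ↔ _
  rw [QuotientAddGroup.eq_zero_iff, AddSubgroup.mem_addSubgroupOf]

end ChowGroup

end Rat

section Pushforward

variable {X Y Z : Scheme.{u}}

lemma finite_preimage_singleton_inter_support (f : X ⟶ Y) [QuasiCompact f]
    (c : AlgebraicCycle X ℤ) (y : Y) : (f.base ⁻¹' {y} ∩ Function.support c).Finite := by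
  obtain ⟨U, ⟨hUo, hUc⟩, hyU, -⟩ :=
    (PrespectralSpace.isTopologicalBasis (X := Y)).exists_subset_of_mem_open
      (Set.mem_univ y) isOpen_univ
  refine (c.locallyFiniteSupport.finite_inter_support_of_isCompact
    (f.isSpectralMap.2 hUo hUc)).subset ?_
  rintro x ⟨hx, hx'⟩
  exact ⟨show f.base x ∈ U by rwa [show f.base x = y from hx], hx'⟩

lemma algebraicCycleMap_add (f : X ⟶ Y) [QuasiCompact f] {N : Type*} [DecidableEq N]
    (wx : X → N) (wy : Y → N) (c c' : AlgebraicCycle X ℤ) :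
    AlgebraicCycle.map f wx wy (c + c') =
      AlgebraicCycle.map f wx wy c + AlgebraicCycle.map f wx wy c' := by
  ext y
  simp only [AlgebraicCycle.map, Function.locallyFinsuppWithin.coe_add, Pi.add_apply,
    Function.locallyFinsupp.map_apply, add_mul]
  refine finsum_mem_add_distrib' ?_ ?_
  · exact (finite_preimage_singleton_inter_support f c y).subset
      (Set.inter_subset_inter_right _ (Function.support_mul_subset_left _ _))
  · exact (finite_preimage_singleton_inter_support f c' y).subset
      (Set.inter_subset_inter_right _ (Function.support_mul_subset_left _ _))

@[simp]
lemma algebraicCycleMap_zero (f : X ⟶ Y) [QuasiCompact f] {N : Type*} [DecidableEq N]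
    (wx : X → N) (wy : Y → N) : AlgebraicCycle.map f wx wy (0 : AlgebraicCycle X ℤ) = 0 := by
  ext y
  simp [AlgebraicCycle.map]

lemma map_mem_cyclesOfDim (f : X ⟶ Y) [QuasiCompact f] {d : ℕ} {c : AlgebraicCycle X ℤ}
    (hc : c ∈ cyclesOfDim X d) :
    AlgebraicCycle.map f Order.height Order.height c ∈ cyclesOfDim Y d := by
  intro y hy
  simp only [AlgebraicCycle.map, Function.locallyFinsupp.map_apply] at hy
  obtain ⟨x, hx, hx'⟩ := exists_ne_zero_of_finsum_mem_ne_zero hy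
  have hcx : c x ≠ 0 := fun h ↦ hx' (by simp [h])
  have hw : Order.height x = Order.height (f.base x) := by
    by_contra h
    exact hx' (by simp [AlgebraicCycle.mapCoeff, h])
  rw [Set.mem_preimage, Set.mem_singleton_iff] at hx
  rw [← hx, ← hw, hc x hcx]

variable (d : ℕ)

noncomputable def cyclesOfDimMap (f : X ⟶ Y) [QuasiCompact f] :
    ↥(cyclesOfDim X d) →+ ↥(cyclesOfDim Y d) where
  toFun c := ⟨AlgebraicCycle.map f Order.height Order.height c, map_mem_cyclesOfDim f c.2⟩
  map_zero' := Subtype.ext (algebraicCycleMap_zero f _ _)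
  map_add' c c' := Subtype.ext (algebraicCycleMap_add f _ _ c c')

@[simp]
lemma coe_cyclesOfDimMap (f : X ⟶ Y) [QuasiCompact f] (c : ↥(cyclesOfDim X d)) :
    (cyclesOfDimMap d f c : AlgebraicCycle Y ℤ) = AlgebraicCycle.map f Order.height Order.height c :=
  rfl

variable {k : Type u} [Field k]

def map_mem_ratTrivial : Prop :=
  ∀ {X Y : SchemeOver k} (f : X ⟶ Y) [IsProper f.left] [LocallyOfFiniteType X.hom] [LocallyOfFiniteType Y.hom]
    {c : AlgebraicCycle X.left ℤ},
    c ∈ ratTrivial X.left d → AlgebraicCycle.map f.left Order.height Order.height c ∈ ratTrivial Y.left d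

noncomputable def ChowGroup.pushforward (h : map_mem_ratTrivial d (k := k)) {X Y : SchemeOver k}
    (f : X ⟶ Y) [IsProper f.left] [LocallyOfFiniteType X.hom] [LocallyOfFiniteType Y.hom] :
    ChowGroup X.left d →+ ChowGroup Y.left d :=
  QuotientAddGroup.map _ _ (cyclesOfDimMap d f.left) fun c hc ↦ by
    rw [AddSubgroup.mem_comap, AddSubgroup.mem_addSubgroupOf, coe_cyclesOfDimMap]
    exact h f (AddSubgroup.mem_addSubgroupOf.mp hc)

@[simp]
lemma ChowGroup.pushforward_mk (h : map_mem_ratTrivial d (k := k)) {X Y : SchemeOver k}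
    (f : X ⟶ Y) [IsProper f.left] [LocallyOfFiniteType X.hom] [LocallyOfFiniteType Y.hom]
    (c : ↥(cyclesOfDim X.left d)) :
    ChowGroup.pushforward d h f (ChowGroup.mk X.left d c) =
      ChowGroup.mk Y.left d (cyclesOfDimMap d f.left c) :=
  rfl

def ChowGroup.pushforward_comp : Prop :=
  ∀ (h : map_mem_ratTrivial d (k := k)) {X Y Z : SchemeOver k} (f : X ⟶ Y) (g : Y ⟶ Z)
    [IsProper f.left] [IsProper g.left] [IsProper (f ≫ g).left]
    [LocallyOfFiniteType X.hom] [LocallyOfFiniteType Y.hom] [LocallyOfFiniteType Z.hom],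
    ChowGroup.pushforward d h (f ≫ g) =
      (ChowGroup.pushforward d h g).comp (ChowGroup.pushforward d h f)

end Pushforward

def cyclesOfCodim_eq_cyclesOfDim : Prop :=
  ∀ {k : Type u} [Field k] {n : ℕ} {X : SchemeOver k}, IsSmoothProjective n X → ∀ {p d : ℕ}, p + d = n →
    cyclesOfCodim X.left p = cyclesOfDim X.left d

section PushforwardComp

variable {X Y Z : Scheme.{u}}

lemma exists_le_base_eq_of_isClosedMap (f : X ⟶ Y) (hf : IsClosedMap f.base) {x : X} {y : Y}
    (h : y ≤ f.base x) : ∃ x' ≤ x, f.base x' = y := by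
  have hy : y ∈ closure {f.base x} := (Scheme.le_iff_specializes.mp h).mem_closure
  have hsub : closure {f.base x} ⊆ f.base '' closure {x} :=
    closure_minimal (Set.singleton_subset_iff.mpr ⟨x, subset_closure rfl, rfl⟩)
      (hf _ isClosed_closure)
  obtain ⟨x', hx', rfl⟩ := hsub hy
  exact ⟨x', Scheme.le_iff_specializes.mpr (specializes_iff_mem_closure.mpr hx'), rfl⟩

lemma exists_lt_base_eq_of_isClosedMap (f : X ⟶ Y) (hf : IsClosedMap f.base) {x : X} {y : Y}
    (h : y < f.base x) : ∃ x' < x, f.base x' = y := by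
  obtain ⟨x', hx', rfl⟩ := exists_le_base_eq_of_isClosedMap f hf h.le
  refine ⟨x', lt_of_le_not_ge hx' fun h' ↦ h.not_ge ?_, rfl⟩
  exact Scheme.le_iff_specializes.mpr ((Scheme.le_iff_specializes.mp h').map f.continuous)

lemma height_base_le_of_isClosedMap (f : X ⟶ Y) (hf : IsClosedMap f.base) (x : X) :
    height (f.base x) ≤ height x := by
  suffices H : ∀ n : ℕ, ∀ x : X, (n : ℕ∞) ≤ height (f.base x) → (n : ℕ∞) ≤ height x from
    ENat.forall_natCast_le_iff_le.mp fun n hn ↦ H n x hn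
  intro n
  induction n with
  | zero => exact fun x _ ↦ by simp
  | succ n ih =>
    intro x hx
    obtain ⟨p, hlast, hlen⟩ := exists_series_of_le_height _ hx
    have hne : p.length ≠ 0 := by omega
    have hlt : p.eraseLast.last < f.base x := hlast ▸ p.eraseLast_last_rel_last hne
    obtain ⟨x', hx'x, hx'⟩ := exists_lt_base_eq_of_isClosedMap f hf hlt
    have h1 : (n : ℕ∞) ≤ height (f.base x') := by
      rw [hx']
      refine le_trans ?_ (length_le_height_last (p := p.eraseLast))
      simp [hlen]
    calc ((n + 1 : ℕ) : ℕ∞) = n + 1 := by push_cast; rfl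
      _ ≤ height x' + 1 := by gcongr; exact ih x' h1
      _ ≤ height x := height_add_one_le hx'x

lemma residueDegree_comp (f : X ⟶ Y) (g : Y ⟶ Z) (x : X) :
    (f ≫ g).residueDegree x = f.residueDegree x * g.residueDegree (f.base x) := by
  letI a1 : Algebra (Z.residueField (g.base (f.base x))) (Y.residueField (f.base x)) :=
    (g.residueFieldMap (f.base x)).hom.toAlgebra
  letI a2 : Algebra (Y.residueField (f.base x)) (X.residueField x) :=
    (f.residueFieldMap x).hom.toAlgebra
  letI a3 : Algebra (Z.residueField (g.base (f.base x))) (X.residueField x) :=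
    ((f ≫ g).residueFieldMap x).hom.toAlgebra
  haveI : IsScalarTower (Z.residueField (g.base (f.base x))) (Y.residueField (f.base x))
      (X.residueField x) :=
    IsScalarTower.of_algebraMap_eq' <|
      show ((f ≫ g).residueFieldMap x).hom =
          (f.residueFieldMap x).hom.comp (g.residueFieldMap (f.base x)).hom by
        rw [Scheme.residueFieldMap_comp]
        rfl
  change Module.finrank (Z.residueField (g.base (f.base x))) (X.residueField x) =
    Module.finrank (Y.residueField (f.base x)) (X.residueField x) *
      Module.finrank (Z.residueField (g.base (f.base x))) (Y.residueField (f.base x))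
  rw [mul_comm]
  exact (Module.finrank_mul_finrank _ _ _).symm

lemma mapCoeff_comp_height (f : X ⟶ Y) (g : Y ⟶ Z) (hf : IsClosedMap f.base)
    (hg : IsClosedMap g.base) (x : X) :
    AlgebraicCycle.mapCoeff (f ≫ g) height height x =
      AlgebraicCycle.mapCoeff f height height x *
        AlgebraicCycle.mapCoeff g height height (f.base x) := by
  have h1 := height_base_le_of_isClosedMap f hf x
  have h2 := height_base_le_of_isClosedMap g hg (f.base x)
  simp only [AlgebraicCycle.mapCoeff]
  rw [Scheme.Hom.comp_apply]
  by_cases h : height x = height (g.base (f.base x))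
  · have h' : height (f.base x) = height (g.base (f.base x)) := le_antisymm (h ▸ h1) h2
    have h'' : height x = height (f.base x) := h.trans h'.symm
    rw [if_pos h, if_pos h'', if_pos h', residueDegree_comp]
  · rw [if_neg h]
    by_cases h'' : height x = height (f.base x)
    · have h' : ¬ height (f.base x) = height (g.base (f.base x)) := fun e ↦ h (h''.trans e)
      rw [if_neg h', mul_zero]
    · rw [if_neg h'', zero_mul]

lemma finsum_mem_preimage_comp {α β γ M : Type*} [AddCommMonoid M] (f : α → β) (g : β → γ)
    (F : α → M) (z : γ) (hfin : ((g ∘ f) ⁻¹' {z} ∩ Function.support F).Finite) :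
    ∑ᶠ x ∈ (g ∘ f) ⁻¹' {z}, F x = ∑ᶠ y ∈ g ⁻¹' {z}, ∑ᶠ x ∈ f ⁻¹' {y}, F x := by
  classical
  set S := hfin.toFinset with hS
  have hmem : ∀ x, x ∈ S ↔ g (f x) = z ∧ F x ≠ 0 := fun x ↦ by simp [hS]
  have hL : ∑ᶠ x ∈ (g ∘ f) ⁻¹' {z}, F x = ∑ x ∈ S, F x :=
    finsum_mem_eq_sum_of_subset _ (by simp [hS]) fun x hx ↦ ((hmem x).mp hx).1
  have hinner : ∀ y ∈ g ⁻¹' {z}, ∑ᶠ x ∈ f ⁻¹' {y}, F x = ∑ x ∈ S with f x = y, F x := by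
    intro y hy
    refine finsum_mem_eq_sum_of_subset _ ?_ ?_
    · rintro x ⟨hx, hx'⟩
      have hx : f x = y := hx
      simp only [Finset.coe_filter, Set.mem_setOf_eq, hmem]
      exact ⟨⟨by rw [hx]; exact hy, hx'⟩, hx⟩
    · intro x hx
      simp only [Finset.coe_filter, Set.mem_setOf_eq] at hx
      exact hx.2
  rw [hL, finsum_mem_congr rfl hinner]
  have hmaps : ∀ x ∈ S, f x ∈ S.image f := fun x hx ↦ Finset.mem_image_of_mem f hx
  rw [finsum_mem_eq_sum_of_subset _ (t := S.image f), Finset.sum_fiberwise_of_maps_to hmaps]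
  · rintro y ⟨-, hy⟩
    exact Finset.support_of_fiberwise_sum_subset_image S F f hy
  · intro y hy
    obtain ⟨x, hx, rfl⟩ := Finset.mem_image.mp hy
    exact ((hmem x).mp hx).1

lemma algebraicCycleMap_comp (f : X ⟶ Y) (g : Y ⟶ Z) [QuasiCompact f] [QuasiCompact g]
    [QuasiCompact (f ≫ g)] (hf : IsClosedMap f.base) (hg : IsClosedMap g.base)
    (c : AlgebraicCycle X ℤ) :
    AlgebraicCycle.map (f ≫ g) height height c =
      AlgebraicCycle.map g height height (AlgebraicCycle.map f height height c) := by
  ext z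
  simp only [AlgebraicCycle.map, Function.locallyFinsupp.map_apply]
  simp_rw [mapCoeff_comp_height f g hf hg, Nat.cast_mul, ← mul_assoc]
  have hfin : ((g.base ∘ f.base) ⁻¹' {z} ∩ Function.support fun x ↦ c x *
      (AlgebraicCycle.mapCoeff f height height x : ℤ) *
        (AlgebraicCycle.mapCoeff g height height (f.base x) : ℤ)).Finite := by
    refine (finite_preimage_singleton_inter_support (f ≫ g) c z).subset ?_
    refine Set.inter_subset_inter (fun x hx ↦ by simpa using hx) ?_
    exact (Function.support_mul_subset_left _ _).trans (Function.support_mul_subset_left _ _)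
  rw [show ((f ≫ g).base ⁻¹' {z}) = (g.base ∘ f.base) ⁻¹' {z} from by ext; simp,
    finsum_mem_preimage_comp f.base g.base _ z hfin]
  refine finsum_mem_congr rfl fun y hy ↦ ?_
  rw [finsum_mem_mul]
  refine finsum_mem_congr rfl fun x hx ↦ ?_
  rw [show f.base x = y from hx]

variable (d : ℕ) {k : Type u} [Field k]

theorem ChowGroup.pushforward_comp_holds : ChowGroup.pushforward_comp d (k := k) := by
  intro h X Y Z f g _ _ _ _ _ _
  ext x
  induction x using ChowGroup.induction_on with
  | h c =>
    simp only [AddMonoidHom.comp_apply, ChowGroup.pushforward_mk]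
    congr 1
    apply Subtype.ext
    simp only [coe_cyclesOfDimMap]
    exact algebraicCycleMap_comp f.left g.left f.left.isClosedMap g.left.isClosedMap c

end PushforwardComp

end HostAPI.Carriers.AlgebraicGeometry.Motives
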